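import Mathlib
import HarnessLib
import Summits.CriticalPhenomena.CardyFormulaZ2.Theses.CardyRotToConf
import Summits.CriticalPhenomena.CardyFormulaZ2.Theorems.CardySelfRefinementSymmetryUpgradeRReversible
import Summits.CriticalPhenomena.CardyFormulaZ2.Theorems.CardySelfRefinementSymmetryUpgradeRReflectionCovariant
import Summits.CriticalPhenomena.CardyFormulaZ2.Theorems.CardyRotToConfR2SymmetryUpgradeLocalityPinsSix
import Literature.Probability.RandomPlanarGeometry.SLELawOneDomainReduction
import Literature.Probability.RandomPlanarGeometry.ChordalReversibility
import Literature.Probability.RandomPlanarGeometry.IsometryCovariance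
import Literature.Probability.Percolation.BondInterfaceMeasurability

/-!
# Birth skeleton (BC3) for crux `CardyRotToConfR2SymmetryUpgradeR`
# — route `CardyRotToConf`, item stmt-CriticalPhenomena-17237 (rank 2, REPAIRED r2 of 2026-08-16)

Crux (fixed, BY NAME): `Summit.CriticalPhenomena.CardyFormulaZ2.Theses.CardyRotToConf.CardyRotToConfR2SymmetryUpgradeR`
= "assume every Dobrushin domain is ℤ²-discretisable; then every similarity-covariant, domain-Markov, local,
target-independent chordal family `P` which a.s. traces no boundary arc AND is a subsequential scaling limit of the
bond-ℤ² (`p = ½`) exploration interfaces along ONE mesh sequence (clause (iv): for every Dobrushin `D` and every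
`ZdDiscretisationFamily E` of `D`) is chordal SLE₆ in every Dobrushin domain".

THE CUT (the route header's foreseen split (II)/(III) of `NOT DECOMPOSED YET`, with (I) = the lattice regularity now
supplied by LANDED theorems, and (III) reduced by LANDED theorems to its κ-free one-domain core):

* `stub_conformalFront` (II · THE FRONT END; open problem, no printed mechanism): admissible + non-tracing +
  clause (iv) ⇒ `P.IsConformallyCovariant`. VERBATIM (same text, same fact-free vocabulary `Interface.bondInterfaceIn`) the registered stub
  `stub_conformalFront` of line `SketchIdeatorTwo` of the sibling crux `CardySelfRefinement.SymmetryUpgradeR` (stmt-CriticalPhenomena-17239), which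
  is EQUIVALENT to this crux (landed `Theorems.symmetryUpgradeR_iff_cardyRotToConfR2SymmetryUpgradeR`, p133665): the
  two cruxes are one open problem and this obligation is shared, staffed once.
* `stub_pinnedSchrammPrincipleOne` (III · TYPED SCHRAMM PRINCIPLE, κ-free, ONE domain, pinned by the lattice; open,
  crux-sized): an admissible, non-tracing, conformally covariant, isometry-covariant, reversible chordal family
  satisfying clause (iv) is, in the unit disc `(𝔻; 1, −1)`, the chordal SLE_κ law for SOME `κ > 0` (Schramm 2000 §1;
  Werner 2007 Lemma 3.3 / §3.2–3.8: conformal covariance + domain Markov ⇒ driving process with stationary independent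
  increments and Brownian scaling ⇒ `√κ B`). It is the WEAKEST common core of the two recorded back ends: the
  lattice-free `stub_typedSchrammPrincipleOne` of the predecessor crux stmt-CriticalPhenomena-0698 (three hypotheses
  fewer) and the sibling's `stub_pinnedSchrammLSW` (conclusion `IsSLELaw 6` on all domains) each imply it in one line;
  conversely the glue below upgrades it to SLE₆ EVERYWHERE using only landed theorems. Typed obstruction on record
  (why it is open, not bookkeeping): `IsMarkovExtension.domain` pins the Markov kernel to `P`'s own law only at JORDAN
  remaining sets (`Negative.MarkovRenewal.kernel_eq_of_jordan_remaining`), so Schramm's i.i.d.-increment step needs a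
  boundary-renewal argument — or clause (iv): the discrete exploration IS exactly Markov in slit domains, which is why
  the lattice pin is kept as a hypothesis (it also keeps every germ-rule / label-transport junk of
  `Cruxes/CardyRotToConfR2SymmetryUpgrade/Disproof.lean` §§10–14 out: none is a lattice limit).

GLUE (sorry-free; LANDED theorems used, all load-bearing):
`Literature.Probability.Percolation.measurable_bondInterfaceIn` (clause (iii) of the sibling's `ClauseIV` is free),
`Theorems.SymmetryUpgradeR.SwallowingSkeleton.stub_reversible` (p134454: clause (iv) + locality ⇒ `P.IsReversible`),
`Theorems.SymmetryUpgradeR.SwallowingSkeleton.stub_reflectionCovariant` (p135156: clause (iv) ⇒ `P.IsIsometryCovariant`),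
`ChordalFamily.IsConformallyCovariant.isSLELaw_of_isSLELaw` (one-domain reduction, Lawler 2005 §6.1),
`Theorems.CardyRotToConfR2SymmetryUpgrade.IsotropyKillsBeltrami.stub_localityPinsSix` (p87067: target independence
pins `κ = 6` among SLE_κ families, LSW 2001 §3 / Werner 2007 Prop. 3.4).
`CardyRotToConfR2SymmetryUpgradeR_of : <stub₁-sig> → <stub₂-sig> → CardyRotToConfR2SymmetryUpgradeR` is the BC3 shape;
`cardyRotToConfR2SymmetryUpgradeR_of_stubs : CardyRotToConfR2SymmetryUpgradeR` is the A12 shape audited by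
`ledger skeleton check` (no hypotheses, concludes the crux BY NAME, reaches it from the two `stub_*` only).
Sorries: exactly the two `stub_*`. The crux's discretisability antecedent is not consumed by the glue (it is a tree
theorem anyway: `Cruxes.LagHandOff.HittingTournament.stub_discretisable`, used inside the landed p135156).

Disproof used: no `Disproof.lean` exists yet for stmt-17237 (`ledger crux ls`: no workfiles); the predecessor's
`crux_false_without_isChordal` / `_targetClause` / `_probability` (Negative/LoadBearing.lean) are honoured — both stubs
carry the full `IsLocalMarkovChordalFamily` bundle and non-tracing; the refuting witness of stmt-0698
(`Theorems.not_CardyRotToConfR2SymmetryUpgrade`, fat-germ surgery) fails clause (iv), a hypothesis of both stubs.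
-/

noncomputable section

namespace Summit.CriticalPhenomena.CardyFormulaZ2.Cruxes.CardyRotToConfR2SymmetryUpgradeR.Birth

open MeasureTheory Filter Set
open Literature.Probability.RandomPlanarGeometry Literature.Probability.LatticeModels
open Literature.Probability.Percolation

/-! ### Abbreviations used by the glue only (the stubs are spelled out in full) -/

/-- Clause (ii): `P D`-a.s. the curve traces no boundary arc. -/
def NonTracing (P : ChordalFamily) : Prop :=
  ∀ D : DobrushinDomain, ∀ᵐ γ ∂(P D), ∀ c : Curve ℂ, CurveClass.mk c = γ →
    ∀ s t : unitInterval, s < t → c '' Set.Icc s t ⊆ frontier D.carrier →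
      (c '' Set.Icc s t).Subsingleton

/-- Clauses (iii)+(iv) in the sibling crux's form: interfaces eventually a.e.-measurable (free, by
`measurable_bondInterfaceIn`) and `P` is the sequential bond-ℤ² interface limit along ONE mesh sequence on every
admissibly discretised Dobrushin domain. -/
def ClauseIV (P : ChordalFamily) : Prop :=
  (∀ (D : DobrushinDomain) (E : ℝ → DiscreteDobrushin), ZdDiscretisationFamily D E →
      ∀ᶠ δ in nhdsWithin (0 : ℝ) (Set.Ioi 0),
        AEMeasurable (Interface.bondInterfaceIn D (E δ)) (bondPercolation (zdGraph 2) half)) ∧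
    ∃ δs : ℕ → ℝ, (∀ n, 0 < δs n) ∧ Tendsto δs atTop (nhds 0) ∧
      ∀ (D : DobrushinDomain) (E : ℝ → DiscreteDobrushin), ZdDiscretisationFamily D E →
        ∀ f : BoundedContinuousFunction (CurveClass ℂ) ℝ,
          Tendsto (fun n => ∫ ω, f (Interface.bondInterfaceIn D (E (δs n)) ω) ∂(bondPercolation (zdGraph 2) half))
            atTop (nhds (∫ γ, f γ ∂(P D)))

/-! ### The two registered stubs -/

/-- Registered stub `stub_conformalFront` (II · THE FRONT END — "Euclidean + scale + Markov + locality ⇒ conformal"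
FOR THE ℤ² PERCOLATION INTERFACE LIMIT; open problem, XL). A chordal family that is similarity covariant, domain
Markov, local, target independent, a.s. traces no boundary arc, and is the bond-ℤ² (`p = ½`) interface scaling limit
along one mesh sequence on every admissibly discretised Dobrushin domain (clause (iv)) is conformally covariant
(`ChordalFamily.IsConformallyCovariant`, Werner 2007 §3.2 (1)). VERBATIM the sibling crux's registered
`SymmetryUpgradeR.SwallowingSkeleton.stub_conformalFront` (stmt-CriticalPhenomena-17239 ↔ this crux, p133665): one
shared obligation. Why it might fail / why open: no printed mechanism (Schramm 2000 §1 and Werner 2007 §3.2 take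
conformal covariance as INPUT; the lattice side is Smirnov 2006 ICM Conj. 4 at `q = 1`; DKKMO arXiv:2012.11672 §1.1
names "scaling and rotation invariance … then conformal invariance" as the road not taken); barrier
`Literature.Barriers.CriticalPhenomena.ScaleCovarianceNotMoebius` says symmetry data alone do not upgrade — the
model input here is clause (iv) (+ Markov, locality); for such `P` reversibility and achirality are already THEOREMS
(p134454, p135156). The discretisability of every Dobrushin domain, needed to let (iv) pin `P D` for every `D`, is
the tree theorem `Cruxes.LagHandOff.HittingTournament.stub_discretisable`. -/
theorem stub_conformalFront :
    ∀ P : ChordalFamily, IsLocalMarkovChordalFamily P →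
      (∀ D : DobrushinDomain, ∀ᵐ γ ∂(P D), ∀ c : Curve ℂ, CurveClass.mk c = γ →
        ∀ s t : unitInterval, s < t → c '' Set.Icc s t ⊆ frontier D.carrier →
          (c '' Set.Icc s t).Subsingleton) →
      ((∀ (D : DobrushinDomain) (E : ℝ → DiscreteDobrushin), ZdDiscretisationFamily D E →
          ∀ᶠ δ in nhdsWithin (0 : ℝ) (Set.Ioi 0),
            AEMeasurable (Interface.bondInterfaceIn D (E δ)) (bondPercolation (zdGraph 2) half)) ∧
        ∃ δs : ℕ → ℝ, (∀ n, 0 < δs n) ∧ Tendsto δs atTop (nhds 0) ∧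
          ∀ (D : DobrushinDomain) (E : ℝ → DiscreteDobrushin), ZdDiscretisationFamily D E →
            ∀ f : BoundedContinuousFunction (CurveClass ℂ) ℝ,
              Tendsto (fun n => ∫ ω, f (Interface.bondInterfaceIn D (E (δs n)) ω) ∂(bondPercolation (zdGraph 2) half))
                atTop (nhds (∫ γ, f γ ∂(P D)))) →
      P.IsConformallyCovariant := by
  sorry

/-- Registered stub `stub_pinnedSchrammPrincipleOne` (III · TYPED SCHRAMM PRINCIPLE FOR THE PINNED FAMILY, κ-free,
one domain; open, crux-sized). A conformally covariant, isometry covariant, reversible, local, target-independent,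
domain-Markov chordal family that a.s. traces no boundary arc and is the bond-ℤ² interface limit of clause (iv) is,
in the unit disc `(𝔻; 1, −1)` (`DobrushinDomain.unitDisc`), the chordal SLE_κ law for SOME `κ > 0` (Schramm 2000
§1; Werner 2007 Lemma 3.3, §3.2–3.8: conformal covariance + domain Markov ⇒ the driving process of the Loewner
chain has stationary independent increments and Brownian scaling ⇒ `√κ B`; identification of the law via
`IsSLELaw`). κ is NOT pinned here (target independence does that downstream, landed `stub_localityPinsSix`), and
only ONE domain is asked (conformal covariance transports it, landed `IsConformallyCovariant.isSLELaw_of_isSLELaw`).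
Weakest common core of the predecessor's lattice-free `stub_typedSchrammPrincipleOne` (stmt-0698; drop the last
three hypotheses) and the sibling's `stub_pinnedSchrammLSW` (stmt-17239; specialise its conclusion to `𝔻`, κ := 6).
Why it might fail / why open: the typed Markov axiom `IsMarkovExtension.domain` pins the kernel to `P` only at
JORDAN remaining sets (`Negative.MarkovRenewal.kernel_eq_of_jordan_remaining`), so the i.i.d.-increment step must
come from boundary-arc renewals or from clause (iv) (the discrete exploration is exactly Markov in slit domains);
false iff some such pinned family has a non-Brownian driving process. -/
theorem stub_pinnedSchrammPrincipleOne :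
    ∀ P : ChordalFamily, IsLocalMarkovChordalFamily P →
      (∀ D : DobrushinDomain, ∀ᵐ γ ∂(P D), ∀ c : Curve ℂ, CurveClass.mk c = γ →
        ∀ s t : unitInterval, s < t → c '' Set.Icc s t ⊆ frontier D.carrier →
          (c '' Set.Icc s t).Subsingleton) →
      ((∀ (D : DobrushinDomain) (E : ℝ → DiscreteDobrushin), ZdDiscretisationFamily D E →
          ∀ᶠ δ in nhdsWithin (0 : ℝ) (Set.Ioi 0),
            AEMeasurable (Interface.bondInterfaceIn D (E δ)) (bondPercolation (zdGraph 2) half)) ∧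
        ∃ δs : ℕ → ℝ, (∀ n, 0 < δs n) ∧ Tendsto δs atTop (nhds 0) ∧
          ∀ (D : DobrushinDomain) (E : ℝ → DiscreteDobrushin), ZdDiscretisationFamily D E →
            ∀ f : BoundedContinuousFunction (CurveClass ℂ) ℝ,
              Tendsto (fun n => ∫ ω, f (Interface.bondInterfaceIn D (E (δs n)) ω) ∂(bondPercolation (zdGraph 2) half))
                atTop (nhds (∫ γ, f γ ∂(P D)))) →
      P.IsConformallyCovariant → P.IsIsometryCovariant → P.IsReversible →
      ∃ κ : NNReal, 0 < κ ∧ IsSLELaw κ DobrushinDomain.unitDisc (P DobrushinDomain.unitDisc) := by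
  sorry

/-! ### Glue (sorry-free) -/

/-- **Back end, assembled from stub (III) and the landed theorems.** If the pinned κ-free one-domain Schramm
principle holds (hypothesis `h₂` = the statement of `stub_pinnedSchrammPrincipleOne`), then every admissible,
non-tracing, conformally covariant family satisfying `ClauseIV` is chordal SLE₆ in EVERY Dobrushin domain:
reversibility (p134454) and achirality (p135156) of such `P` are theorems; `h₂` gives SLE_κ in `𝔻` for some
`κ > 0`; conformal covariance transports it to every domain (`IsConformallyCovariant.isSLELaw_of_isSLELaw`);
target independence pins `κ = 6` (`stub_localityPinsSix`, p87067). This is also the sibling's registered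
`stub_pinnedSchrammLSW` derived from the weaker (III). -/
theorem isSLELaw_six_of_schrammPrincipleOne
    (h₂ : ∀ P : ChordalFamily, IsLocalMarkovChordalFamily P →
      (∀ D : DobrushinDomain, ∀ᵐ γ ∂(P D), ∀ c : Curve ℂ, CurveClass.mk c = γ →
        ∀ s t : unitInterval, s < t → c '' Set.Icc s t ⊆ frontier D.carrier →
          (c '' Set.Icc s t).Subsingleton) →
      ((∀ (D : DobrushinDomain) (E : ℝ → DiscreteDobrushin), ZdDiscretisationFamily D E →
          ∀ᶠ δ in nhdsWithin (0 : ℝ) (Set.Ioi 0),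
            AEMeasurable (Interface.bondInterfaceIn D (E δ)) (bondPercolation (zdGraph 2) half)) ∧
        ∃ δs : ℕ → ℝ, (∀ n, 0 < δs n) ∧ Tendsto δs atTop (nhds 0) ∧
          ∀ (D : DobrushinDomain) (E : ℝ → DiscreteDobrushin), ZdDiscretisationFamily D E →
            ∀ f : BoundedContinuousFunction (CurveClass ℂ) ℝ,
              Tendsto (fun n => ∫ ω, f (Interface.bondInterfaceIn D (E (δs n)) ω) ∂(bondPercolation (zdGraph 2) half))
                atTop (nhds (∫ γ, f γ ∂(P D)))) →
      P.IsConformallyCovariant → P.IsIsometryCovariant → P.IsReversible →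
      ∃ κ : NNReal, 0 < κ ∧ IsSLELaw κ DobrushinDomain.unitDisc (P DobrushinDomain.unitDisc))
    (P : ChordalFamily) (hP : IsLocalMarkovChordalFamily P) (hnt : NonTracing P) (hIV : ClauseIV P)
    (hcov : P.IsConformallyCovariant) : ∀ D : DobrushinDomain, IsSLELaw 6 D (P D) := by
  -- (I) lattice regularity, LANDED: reversibility and achirality of the clause-(iv) family
  have hrev : P.IsReversible :=
    Summit.CriticalPhenomena.CardyFormulaZ2.Theorems.SymmetryUpgradeR.SwallowingSkeleton.stub_reversible
      P hP hnt hIV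
  have hiso : P.IsIsometryCovariant :=
    Summit.CriticalPhenomena.CardyFormulaZ2.Theorems.SymmetryUpgradeR.SwallowingSkeleton.stub_reflectionCovariant
      P hP hnt hIV
  -- (III) Schramm's principle in the unit disc, κ free
  obtain ⟨κ, hκ, hdisc⟩ := h₂ P hP hnt hIV hcov hiso hrev
  -- one-domain reduction by conformal covariance
  have hall : ∀ D : DobrushinDomain, IsSLELaw κ D (P D) := hcov.isSLELaw_of_isSLELaw hdisc
  -- target independence pins κ = 6 (LSW locality, landed)
  obtain rfl : κ = 6 :=
    Summit.CriticalPhenomena.CardyFormulaZ2.Theorems.CardyRotToConfR2SymmetryUpgrade.IsotropyKillsBeltrami.stub_localityPinsSix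
      κ P hκ hall hP.isLocal hP.targetIndependent
  exact hall

/-- **BC3 shape**: the two stub STATEMENTS (verbatim the types of `stub_conformalFront` and
`stub_pinnedSchrammPrincipleOne`) imply the crux, concluded BY NAME. Kernel-checked, no `sorry`, no stub used. -/
theorem CardyRotToConfR2SymmetryUpgradeR_of :
    (∀ P : ChordalFamily, IsLocalMarkovChordalFamily P →
      (∀ D : DobrushinDomain, ∀ᵐ γ ∂(P D), ∀ c : Curve ℂ, CurveClass.mk c = γ →
        ∀ s t : unitInterval, s < t → c '' Set.Icc s t ⊆ frontier D.carrier →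
          (c '' Set.Icc s t).Subsingleton) →
      ((∀ (D : DobrushinDomain) (E : ℝ → DiscreteDobrushin), ZdDiscretisationFamily D E →
          ∀ᶠ δ in nhdsWithin (0 : ℝ) (Set.Ioi 0),
            AEMeasurable (Interface.bondInterfaceIn D (E δ)) (bondPercolation (zdGraph 2) half)) ∧
        ∃ δs : ℕ → ℝ, (∀ n, 0 < δs n) ∧ Tendsto δs atTop (nhds 0) ∧
          ∀ (D : DobrushinDomain) (E : ℝ → DiscreteDobrushin), ZdDiscretisationFamily D E →
            ∀ f : BoundedContinuousFunction (CurveClass ℂ) ℝ,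
              Tendsto (fun n => ∫ ω, f (Interface.bondInterfaceIn D (E (δs n)) ω) ∂(bondPercolation (zdGraph 2) half))
                atTop (nhds (∫ γ, f γ ∂(P D)))) →
      P.IsConformallyCovariant) →
    (∀ P : ChordalFamily, IsLocalMarkovChordalFamily P →
      (∀ D : DobrushinDomain, ∀ᵐ γ ∂(P D), ∀ c : Curve ℂ, CurveClass.mk c = γ →
        ∀ s t : unitInterval, s < t → c '' Set.Icc s t ⊆ frontier D.carrier →
          (c '' Set.Icc s t).Subsingleton) →
      ((∀ (D : DobrushinDomain) (E : ℝ → DiscreteDobrushin), ZdDiscretisationFamily D E →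
          ∀ᶠ δ in nhdsWithin (0 : ℝ) (Set.Ioi 0),
            AEMeasurable (Interface.bondInterfaceIn D (E δ)) (bondPercolation (zdGraph 2) half)) ∧
        ∃ δs : ℕ → ℝ, (∀ n, 0 < δs n) ∧ Tendsto δs atTop (nhds 0) ∧
          ∀ (D : DobrushinDomain) (E : ℝ → DiscreteDobrushin), ZdDiscretisationFamily D E →
            ∀ f : BoundedContinuousFunction (CurveClass ℂ) ℝ,
              Tendsto (fun n => ∫ ω, f (Interface.bondInterfaceIn D (E (δs n)) ω) ∂(bondPercolation (zdGraph 2) half))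
                atTop (nhds (∫ γ, f γ ∂(P D)))) →
      P.IsConformallyCovariant → P.IsIsometryCovariant → P.IsReversible →
      ∃ κ : NNReal, 0 < κ ∧ IsSLELaw κ DobrushinDomain.unitDisc (P DobrushinDomain.unitDisc)) →
    Summit.CriticalPhenomena.CardyFormulaZ2.Theses.CardyRotToConf.CardyRotToConfR2SymmetryUpgradeR := by
  intro h₁ h₂ _hDisc P hP hnt hseq D
  -- clause (iii) of the sibling form is free (`measurable_bondInterfaceIn`); the crux's clause (iv) is stated over
  -- `Literature.Probability.Percolation.bondInterfaceIn` (InterfaceScalingLimitDiscretised), the stubs over the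
  -- fact-free copy `Interface.bondInterfaceIn` (InterfaceCurves): same body, `Interface.bondInterfaceIn_eq_bondInterfaceIn`
  -- is `rfl`, so the conversion is definitional.
  have hIV : ClauseIV P :=
    ⟨fun D' E' _ => Filter.Eventually.of_forall fun δ => (measurable_bondInterfaceIn D' (E' δ)).aemeasurable, hseq⟩
  exact isSLELaw_six_of_schrammPrincipleOne h₂ P hP hnt hIV (h₁ P hP hnt hIV) D

/-- **A12 shape** (audited by `ledger skeleton check`: no hypotheses, concludes the crux BY NAME, reaches it from
the two registered stubs only; `sorryAx` enters only through `stub_conformalFront` and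
`stub_pinnedSchrammPrincipleOne`). It becomes a closed proof of stmt-CriticalPhenomena-17237 exactly when the two
stubs are proved. -/
theorem cardyRotToConfR2SymmetryUpgradeR_of_stubs :
    Summit.CriticalPhenomena.CardyFormulaZ2.Theses.CardyRotToConf.CardyRotToConfR2SymmetryUpgradeR :=
  CardyRotToConfR2SymmetryUpgradeR_of stub_conformalFront stub_pinnedSchrammPrincipleOne

end Summit.CriticalPhenomena.CardyFormulaZ2.Cruxes.CardyRotToConfR2SymmetryUpgradeR.Birth

end
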